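import Summits.Ventures.PackingBounds.Energy.FivePointRieszSevenDefs
import HarnessLib

/-!
# `FivePointRieszSeven`: the value of the bound `5(4c - F(1,1,1) - a₁) = 1/64 + 3/4√2 + 2/27√3`

Framing: lottery ticket; floor = certified bounds/negative ranges. Venture `PackingBounds`, cell
`pub-packcert`, energy family E3PT (pub-packcert-energy gen 12 generator `e3pt_lean_d6.py`, run by gen 17 from `code/e3pt/g17/kroute/`; KERNEL-D6 data route).
-/

noncomputable section

namespace Summit.Ventures.PackingBounds.Energy.FivePointRieszSeven

set_option maxRecDepth 20000 in
set_option maxHeartbeats 400000000 in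
/-- The value of the bound: `5(4c - F(1,1,1) - a₁) = 1/64 + 3/4√2 + 2/27√3` (the bipyramid's energy over ordered pairs). -/
theorem bound_eqR7 : (5 : ℝ) * ((5 - 1) * c0KR7 - FexpKR7 1 1 1 - a1KR7 * 1) = (((1 : ℝ)/64) + ((3 : ℝ)/4) * s2R7 + ((2 : ℝ)/27) * s3R7) := by
  unfold c0KR7 FexpKR7 a1KR7; ring

end Summit.Ventures.PackingBounds.Energy.FivePointRieszSeven
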